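import Summits.Langlands.Langlands.Theses.NonParallelVoid
import Summits.Langlands.Langlands.Theorems.NonParallelVoidGapArithmetic
import Literature.NumberTheory.GaloisRepresentations.CalegariEvenFontaineMazurTwo

/-!
# Disproof work file — crux `TensorSquareParallel` (item stmt-Langlands-17009, rank 4 of route `NonParallelVoid`)

Standing disprover `refuter-cdisprove-stmt-Langlands-17009-0`, cycle 1 (2026-08-17).  **VERDICT: NO KILL.**
Everything certified here is `sorry`-free; prose lives in docstrings.  Provers: read §1 (what you must prove is
`False`), §2 (which hypotheses you may ignore / must use), §3 (the abstract-character typings are harmless and HOW to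
discharge them), §4 (stub-by-stub audit of the picked line `merged`).

## Findings (index)

* §1 VOID NORMAL FORM (certified; LANDED def-free as `Theorems/TensorSquareParallel/Negative/VoidNormalForm.lean`,
  p168967 accepted 2026-08-17, commit 647b34c5b5c8, together with the §3 lemmas):
  `tensorSquareParallel_iff_void` — under the negated parity clause (two labels with ODD gap sum) the conclusion
  `∃ g, ∀ label, HT = {a, a+g}` is CONTRADICTORY (`not_parallelConclusion_of_not_parityClause`, from the tree's
  `forall_even_gapSum_of_exists_common_gap`), so the crux IS the statement "no `ρ` satisfies the hypotheses".  A
  refutation is therefore exactly ONE representation `ρ` meeting every hypothesis for THE pinned Fontaine datum.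
* §2 LOAD-BEARING ANALYSIS (typed variants `Without…`, verdict per hypothesis; NO `_false_without_` is certifiable
  in the present tree, for the single reason recorded in §5 (ii)):
  - `¬ BaseChangeType` is DECORATION: by determinant parity at a split `p ≥ 3` (clause (F12) of the pinned datum,
    `det ρ|I_v = ε^{-(a+b)}`), `ρ̄^c ≃ ρ̄ ⊗ χ̄` forces `(a+b) ≡ (a'+b') (mod p-1)`, hence an EVEN gap sum; so in the
    odd-gap regime NO `ρ̄` is of base-change type and the sibling crux `EmptyWeightCore` (stmt-Langlands-17008) is
    vacuous while THIS crux carries the whole odd sector (route-review 2026-08-17 concurs).  Certified here only in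
    the trivial direction `WithoutNotBaseChangeType → TensorSquareVoid`; the converse is 17008's deliverable.
  - `ρ.toGaloisRep.IsIrreducible` is REDUNDANT given `IsResiduallyAbsIrreducible (ρ.restrictField F(ζ_p))`
    (lattice saturation: a `Γ_F`-stable line meets every stable `ℤ̄_p`-lattice in a saturated stable submodule, so
    every reduction is reducible).  Certified modulo the missing tree lemma, stated as `ResAbsIrredForcesIrred`:
    `tensorSquareVoid_iff_withoutIrreducible_of`.
  - BOTH irreducibility hypotheses dropped ⇒ FALSE on paper (`WithoutAnyIrreducibility`, witness in its docstring:
    `ρ = 𝟙 ⊕ ψ_p`, `ψ` an algebraic Hecke character of `F` of infinity type `(1, 2)`, gaps `1` and `2`), not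
    certifiable (§5 (ii)).
  - `¬ ParityClause` dropped (conclusion back to "parallel") ⇒ conjecturally TRUE (Calegari–Mazur) and reachable by
    the SAME tensor-induction mechanism (`ψ = ⊗-Ind ρ` is regular iff the gaps DIFFER, parity irrelevant:
    `tensorWeights_nodup_iff`); the clause only makes the conclusion void.
  - `11 ≤ p`, `p` split, crystalline (vs de Rham), residual absolute irreducibility over `F(ζ_p)`, a.e.
    unramified: TECHNIQUE-load-bearing only (BLGGT Thm C needs `l ≥ 2(n+1) = 10`, PD, big residual image; F12 and
    one-label-per-place need `[F_v : ℚ_p] = 1`; deformation/automorphy engines need finite ramification); dropping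
    any of them leaves a sub-case of `Target` = Calegari–Mazur's parallel-weight prediction, for which no witness
    is known even on paper (Calegari–Mazur 2009 §1; Childers 2021 §1.5; Serban 2021 Conj. 2 p. 8).
* §3 JUNK-LOOPHOLE AUDIT (certified): the two "abstract character" typings — `χ : Γ_F →* k̄ˣ` in the base-change
  clause (no continuity) and `η : Γ_{F(ζ_p)} →* k̄ˣ` in the dihedral predicate of lines `birth/merged` — are NOT
  loopholes: wherever `ρ̄` (and `ρ̄ ∘ θ_τ`) is trivial the trace is `2 ≠ 0` (`p ≠ 2`), so the character is `1`
  there (`twistUnit_eq_one_of_trace`, `dihedralChar_ker_le`, `baseChangeChar_eq_one_of_mem_ker`): every such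
  character factors through the FINITE image of `ρ̄` and is continuous.  Consequence: `¬ BaseChangeType` as typed
  is EQUIVALENT to its continuous-χ reading (not merely stronger, pace the vetting note), and provers of
  `stub_dihedralType_of_trace` may push `η` down to the finite group `im ρ̄` at once.
* §4 LINE `merged` (PICKED 2026-08-17T14:16Z; 7 stubs) — stub-by-stub attack, NO STUB REFUTED (details in the
  docstring of `lineMergedAudit`); two certified small-model facts used by stubs 1 and 3: the four tensor weights
  `{a+a', a+b', b+a', b+b'}` are distinct iff the gaps differ (`tensorWeights_nodup_iff`), and the swap on
  `V ⊗ V` is a `J`-orthogonal involution of trace `2` for the symmetric invertible `J = alt ⊗ alt`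
  (`swap_transpose_mul_J_mul_swap`, `trace_swap`, `J_isSymm`, `det_J`) — so (T2) ∧ (T5) of
  `stub_tensorInductionPD` are jointly satisfiable at the level of linear algebra (the stub is not vacuous-false),
  and the conclusion `tr ψ(c) = 0` of `stub_traceComplexConjugation` genuinely EXCLUDES the swap.
* §5 WHY IT RESISTS (summary for the lead):
  (i) Mathematically the crux is a sub-case of Calegari–Mazur's parallel-weight prediction (arXiv:0708.2451 §1,
  Conj. 1.3; Serban arXiv:1902.03217 p. 8 Conj. 2), itself a consequence of Fontaine–Mazur + reciprocity + Clozel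
  purity; every construction of geometric `ρ` in print (motives over `F`: Hodge symmetry; `r_ι(π)`: purity;
  CM/induced: Weil types force equal gaps — re-derived in `STRATEGY-CENSUS.md §Negation`; `p`-adic families:
  Calegari–Mazur/Childers/Serban meet non-parallel classical weights in no known algebraic point) yields PARALLEL
  weight; deformation theory cannot manufacture a witness either (defect `l₀ = 1`: Kisin's dimension bound
  `dim R^{cris,λ}_S ≥ 1 - l₀ = 0` is NOT raised by allowing ramification at auxiliary primes, each `ℓ ≠ p` framed
  local ring having relative dimension exactly `n²`).  Literature sweep 2026-08-17 (corpus fts+vec, galaxy all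
  stars, ledger negatives): nothing new since Childers 2021 / BCGP 2025 Lemma 4.2.8-type remarks.
  (ii) Formally, a refutation needs ONE `ρ` CERTIFIED, for THE pinned datum `fontainePstAdicCompletion v p hv`, to
  be crystalline with labelled weights `{a < b}` at both places.  The datum's Weil–Deligne half is pinned by
  SPECIFICATION (Hilbert ε over `IsFontaineDatum`, clauses (F1)–(F12)): crystallinity is certifiable only for
  locally unramified `ρ` (structure axiom) and for `ε` itself (F4) — both weight-irregular in rank 2 — and there is
  no `⊕`/`⊗`-closure clause, so not even `𝟙 ⊕ ε` is certifiably crystalline, let alone an irreducible `ρ` with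
  non-parallel weights (whose only sources would be CM characters of non-Galois-invariant type, absent from the
  tree).  Hence neither a junk refutation nor a junk proof exists; the same wall blocks every `_false_without_H`.
  (iii) The seven stubs of `merged` hold on paper against the tree's ACTUAL definitions (`IsDihedralType` =
  `∃ m ≥ 2, PIm ≃* DihedralGroup m`, Klein-four included; `Subgroup.IsEnormous` = ACC+ Def. 6.2.28 verbatim;
  `IsDecomposedGeneric` = ACC+ Def. 4.3.1; `IsCrystallineFramed`; `IsComplexConjugation`), see §4.

Disproof used by others: none yet (first cycle).  Dead lines: none.  Negatives (`ledger negatives --problem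
Langlands`, 4): unrelated.
-/

noncomputable section

set_option linter.dupNamespace false

open scoped NumberField
open IsDedekindDomain Field
open Literature.NumberTheory.GaloisRepresentations Literature.NumberTheory.PAdicHodge
open Summit.Langlands.Langlands.Theses.NonParallelVoid
open Summit.Langlands.Langlands.Theorems.NonParallelVoid

namespace Summit.Langlands.Langlands.Cruxes.TensorSquareParallel.Disproof

/-! ## §0 The hypotheses of the crux as named predicates (verbatim sub-terms of the route file) -/

section Named

variable (F : Type) [Field F] [NumberField F] (p : ℕ) [Fact p.Prime] (ρ : FramedGaloisRep F (PadicAlgCl p) 2)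

/-- `hHT`: de Rham at every `v ∣ p` for THE pinned datum, with two distinct labelled weights `{a < b}` at every
label. [folklore] -/
def RegularShape : Prop :=
  ∀ (v : HeightOneSpectrum (𝓞 F)) (hv : ((p : ℕ) : 𝓞 F) ∈ v.asIdeal),
    (fontainePstAdicCompletion v p hv).IsDeRhamFramed (ρ.toLocal v) ∧
    (letI := (fontainePstAdicCompletion v p hv).algebra;
      ∀ τ : v.adicCompletion F →ₐ[ℚ_[p]] PadicAlgCl p, ∃ a b : ℤ, a < b ∧
        ρ.labelledHodgeTateWeightsAt v (fontainePstAdicCompletion v p hv).algebra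
          (fontainePstAdicCompletion v p hv).𝔅 τ.toRingHom = {a, b})

/-- `hG`: the good regime — `11 ≤ p`, `p` split, crystalline above `p` (pinned), `ρ̄|Γ_{F(ζ_p)}` absolutely
irreducible. [folklore] -/
def GoodRegime : Prop :=
  11 ≤ p ∧ (∃ v w : HeightOneSpectrum (𝓞 F), v ≠ w ∧ ((p : ℕ) : 𝓞 F) ∈ v.asIdeal ∧ ((p : ℕ) : 𝓞 F) ∈ w.asIdeal) ∧
    (∀ (v : HeightOneSpectrum (𝓞 F)) (hv : ((p : ℕ) : 𝓞 F) ∈ v.asIdeal),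
      (fontainePstAdicCompletion v p hv).IsCrystallineFramed (ρ.toLocal v)) ∧
    FramedGaloisRep.IsResiduallyAbsIrreducible (ρ.restrictField (CyclotomicField p F))

/-- `hE`: the parity clause — every pair of labels has EVEN gap sum.  The crux assumes its NEGATION. [folklore] -/
def ParityClause : Prop :=
  ∀ (v : HeightOneSpectrum (𝓞 F)) (hv : ((p : ℕ) : 𝓞 F) ∈ v.asIdeal) (w : HeightOneSpectrum (𝓞 F))
    (hw : ((p : ℕ) : 𝓞 F) ∈ w.asIdeal),
    letI := (fontainePstAdicCompletion v p hv).algebra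
    letI := (fontainePstAdicCompletion w p hw).algebra
    ∀ (τ : v.adicCompletion F →ₐ[ℚ_[p]] PadicAlgCl p) (σ : w.adicCompletion F →ₐ[ℚ_[p]] PadicAlgCl p)
      (a b a' b' : ℤ),
      ρ.labelledHodgeTateWeightsAt v (fontainePstAdicCompletion v p hv).algebra
          (fontainePstAdicCompletion v p hv).𝔅 τ.toRingHom = {a, b} → a < b →
      ρ.labelledHodgeTateWeightsAt w (fontainePstAdicCompletion w p hw).algebra
          (fontainePstAdicCompletion w p hw).𝔅 σ.toRingHom = {a', b'} → a' < b' →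
      Even (b - a + (b' - a'))

/-- `hB`: `ρ̄` is of base-change type — for some `τ ∈ Γ_ℚ ∖ res(Γ_F)` and some (abstract!) character `χ`,
`tr ρ̄(θ_τ σ) = χ(σ) tr ρ̄(σ)` and `det ρ̄(θ_τ σ) = χ(σ)² det ρ̄(σ)`.  The crux assumes its NEGATION. [folklore] -/
def BaseChangeType : Prop :=
  ∃ τ : absoluteGaloisGroup ℚ, τ ∉ Set.range (absGaloisRestrict ℚ F) ∧
    ∃ χ : absoluteGaloisGroup F →* (padicAlgClResidueField p)ˣ, ∀ σ σ' : absoluteGaloisGroup F,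
      absGaloisRestrict ℚ F σ' = τ * absGaloisRestrict ℚ F σ * τ⁻¹ →
        (ρ.residualRep σ').val.trace = (χ σ : padicAlgClResidueField p) * (ρ.residualRep σ).val.trace ∧
        (ρ.residualRep σ').val.det = (χ σ : padicAlgClResidueField p) ^ 2 * (ρ.residualRep σ).val.det

/-- The conclusion: one `g` with every labelled weight multiset of the form `{a, a + g}`. [folklore] -/
def ParallelConclusion : Prop :=
  ∃ g : ℤ, ∀ (v : HeightOneSpectrum (𝓞 F)) (hv : ((p : ℕ) : 𝓞 F) ∈ v.asIdeal),
    letI := (fontainePstAdicCompletion v p hv).algebra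
    ∀ τ : v.adicCompletion F →ₐ[ℚ_[p]] PadicAlgCl p, ∃ a : ℤ,
      ρ.labelledHodgeTateWeightsAt v (fontainePstAdicCompletion v p hv).algebra
        (fontainePstAdicCompletion v p hv).𝔅 τ.toRingHom = {a, a + g}

end Named

/-- Read-back of the crux through the named predicates (definitional). [folklore] -/
theorem tensorSquareParallel_iff_named :
    TensorSquareParallel ↔
      ∀ (F : Type) [Field F] [NumberField F] [Algebra.IsQuadraticExtension ℚ F], NumberField.IsTotallyComplex F →
        ∀ (p : ℕ) [Fact p.Prime] (ρ : FramedGaloisRep F (PadicAlgCl p) 2), ρ.toGaloisRep.IsIrreducible →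
          (∀ᶠ v : HeightOneSpectrum (𝓞 F) in Filter.cofinite, ρ.IsUnramifiedAt v) →
          RegularShape F p ρ → GoodRegime F p ρ → ¬ ParityClause F p ρ → ¬ BaseChangeType F p ρ →
          ParallelConclusion F p ρ :=
  Iff.rfl

/-! ## §1 Void normal form (tightness of the parity hypothesis) -/

/-- **The parity hypothesis makes the conclusion contradictory.**  If two labels have odd gap sum then no common
`g` exists (tree lemma `forall_even_gapSum_of_exists_common_gap`). [folklore] -/
theorem not_parallelConclusion_of_not_parityClause {F : Type} [Field F] [NumberField F] {p : ℕ} [Fact p.Prime]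
    {ρ : FramedGaloisRep F (PadicAlgCl p) 2} (hE : ¬ ParityClause F p ρ) : ¬ ParallelConclusion F p ρ := by
  intro hpar
  apply hE
  intro v hv w hw τ σ a b a' b' h1 _ h3 _
  obtain ⟨g, hg⟩ := hpar
  obtain ⟨x, hx⟩ := hg v hv τ
  obtain ⟨x', hx'⟩ := hg w hw σ
  exact even_gapSum_of_common_gap (hx.symm.trans h1) (hx'.symm.trans h3)

/-- **The void form of the crux**: same binders and hypotheses, conclusion `False`. [folklore] -/
def TensorSquareVoid : Prop :=
  ∀ (F : Type) [Field F] [NumberField F] [Algebra.IsQuadraticExtension ℚ F], NumberField.IsTotallyComplex F →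
    ∀ (p : ℕ) [Fact p.Prime] (ρ : FramedGaloisRep F (PadicAlgCl p) 2), ρ.toGaloisRep.IsIrreducible →
      (∀ᶠ v : HeightOneSpectrum (𝓞 F) in Filter.cofinite, ρ.IsUnramifiedAt v) →
      RegularShape F p ρ → GoodRegime F p ρ → ¬ ParityClause F p ρ → ¬ BaseChangeType F p ρ → False

/-- **`TensorSquareParallel` is exactly the emptiness of its hypothesis set.** [folklore] -/
theorem tensorSquareParallel_iff_void : TensorSquareParallel ↔ TensorSquareVoid := by
  rw [tensorSquareParallel_iff_named]
  refine ⟨fun h F _ _ _ hF p _ ρ hirr hunr hHT hG hE hB => ?_, fun h F _ _ _ hF p _ ρ hirr hunr hHT hG hE hB => ?_⟩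
  · exact not_parallelConclusion_of_not_parityClause hE (h F hF p ρ hirr hunr hHT hG hE hB)
  · exact (h F hF p ρ hirr hunr hHT hG hE hB).elim

/-! ## §2 Load-bearing analysis -/

/-- Variant WITHOUT `¬ BaseChangeType` (void form).  VERDICT: equivalent to the crux — in the odd-gap regime at a
split `p ≥ 3` no `ρ̄` is of base-change type (determinant parity via clause (F12) of the pinned datum:
`det ρ̄|I_v = ω^{-(a+b)}`, `det ρ̄^c|I_v = ω^{-(a'+b')}`, and `ρ̄^c ≃ ρ̄ ⊗ χ̄` would give
`χ̄|I_v ^ 2 = ω^{(a+b)-(a'+b')}` with odd exponent, impossible as `p - 1` is even).  That converse is the content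
of the sibling crux `EmptyWeightCore` (stmt-Langlands-17008, vacuous for the same reason) and is not re-done here
(anti-leakage); only the trivial direction is certified below. [folklore] -/
def WithoutNotBaseChangeType : Prop :=
  ∀ (F : Type) [Field F] [NumberField F] [Algebra.IsQuadraticExtension ℚ F], NumberField.IsTotallyComplex F →
    ∀ (p : ℕ) [Fact p.Prime] (ρ : FramedGaloisRep F (PadicAlgCl p) 2), ρ.toGaloisRep.IsIrreducible →
      (∀ᶠ v : HeightOneSpectrum (𝓞 F) in Filter.cofinite, ρ.IsUnramifiedAt v) →
      RegularShape F p ρ → GoodRegime F p ρ → ¬ ParityClause F p ρ → False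

/-- Dropping `¬ BaseChangeType` can only strengthen the crux. [folklore] -/
theorem tensorSquareVoid_of_withoutNotBaseChangeType (h : WithoutNotBaseChangeType) : TensorSquareVoid :=
  fun F _ _ _ hF p _ ρ hirr hunr hHT hG hE _ => h F hF p ρ hirr hunr hHT hG hE

/-- Variant WITHOUT `ρ.toGaloisRep.IsIrreducible` (void form).  VERDICT: equivalent to the crux, because
`GoodRegime` contains `IsResiduallyAbsIrreducible (ρ.restrictField (CyclotomicField p F))`, which forces `ρ`
irreducible (a `Γ_F`-stable `ℚ̄_p`-line, saturated in any stable `ℤ̄_p`-lattice — `ℤ̄_p` is a valuation ring, so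
rescale a generator to have a unit coordinate — reduces to a `Γ`-stable line of EVERY reduction; a fortiori for the
restriction to `Γ_{F(ζ_p)}`).  The tree has no such lemma yet (searched: `ResidualRepUnique`,
`AbsolutelyIrreducibleReductionBridge`, `ResidualRepScalarExtension` — all concern `ρ̄`, not `ρ`), so the
equivalence is certified MODULO it (`ResAbsIrredForcesIrred`, a correct folklore statement, ~150 Lean lines). [folklore] -/
def WithoutIrreducible : Prop :=
  ∀ (F : Type) [Field F] [NumberField F] [Algebra.IsQuadraticExtension ℚ F], NumberField.IsTotallyComplex F →
    ∀ (p : ℕ) [Fact p.Prime] (ρ : FramedGaloisRep F (PadicAlgCl p) 2),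
      (∀ᶠ v : HeightOneSpectrum (𝓞 F) in Filter.cofinite, ρ.IsUnramifiedAt v) →
      RegularShape F p ρ → GoodRegime F p ρ → ¬ ParityClause F p ρ → ¬ BaseChangeType F p ρ → False

/-- The missing folklore lemma: residual absolute irreducibility of `ρ|Γ_{F(ζ_p)}` forces irreducibility of `ρ`
(Darmon–Diamond–Taylor §2.1; lattice saturation over the valuation ring `ℤ̄_p`). [folklore] -/
def ResAbsIrredForcesIrred : Prop :=
  ∀ (F : Type) [Field F] [NumberField F] (p : ℕ) [Fact p.Prime] (ρ : FramedGaloisRep F (PadicAlgCl p) 2),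
    FramedGaloisRep.IsResiduallyAbsIrreducible (ρ.restrictField (CyclotomicField p F)) →
      ρ.toGaloisRep.IsIrreducible

/-- `IsIrreducible` is redundant, modulo `ResAbsIrredForcesIrred`. [folklore] -/
theorem tensorSquareVoid_iff_withoutIrreducible_of (hres : ResAbsIrredForcesIrred) :
    TensorSquareVoid ↔ WithoutIrreducible :=
  ⟨fun h F _ _ _ hF p _ ρ hunr hHT hG hE hB => h F hF p ρ (hres F p ρ hG.2.2.2) hunr hHT hG hE hB,
    fun h F _ _ _ hF p _ ρ _ hunr hHT hG hE hB => h F hF p ρ hunr hHT hG hE hB⟩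

/-- Variant WITHOUT EITHER irreducibility hypothesis (drop `ρ.toGaloisRep.IsIrreducible` AND the residual
clause of `GoodRegime`).  VERDICT: **FALSE ON PAPER**, not certifiable.  Witness: `F = ℚ(i)` (any imaginary
quadratic), `p ≥ 11` split and prime to the conductor below, `ρ = 𝟙 ⊕ ψ_p` with `ψ` an algebraic Hecke character
of `F` of infinity type `(1, 2)` (exists: the unit group is finite, enlarge the conductor) and `ψ_p` its `p`-adic
avatar: a.e. unramified; crystalline at `v, v̄` with labelled weights `{0, ∓1}` and `{0, ∓2}` (gaps `1`, `2`, odd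
sum); not of base-change type (parity, or directly).  Certification needs (a) `ψ_p` with its weights for
`bdRPeriodRingData` (CM/Lubin–Tate periods: absent) and (b) crystallinity of a DIRECT SUM for THE datum (no
`⊕`-closure clause among (F1)–(F12)) — §5 (ii).  Moral: irreducibility is the one truth-load-bearing hypothesis. [folklore] -/
def WithoutAnyIrreducibility : Prop :=
  ∀ (F : Type) [Field F] [NumberField F] [Algebra.IsQuadraticExtension ℚ F], NumberField.IsTotallyComplex F →
    ∀ (p : ℕ) [Fact p.Prime] (ρ : FramedGaloisRep F (PadicAlgCl p) 2),
      (∀ᶠ v : HeightOneSpectrum (𝓞 F) in Filter.cofinite, ρ.IsUnramifiedAt v) →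
      RegularShape F p ρ →
      (11 ≤ p ∧ (∃ v w : HeightOneSpectrum (𝓞 F), v ≠ w ∧ ((p : ℕ) : 𝓞 F) ∈ v.asIdeal ∧ ((p : ℕ) : 𝓞 F) ∈ w.asIdeal) ∧
        (∀ (v : HeightOneSpectrum (𝓞 F)) (hv : ((p : ℕ) : 𝓞 F) ∈ v.asIdeal),
          (fontainePstAdicCompletion v p hv).IsCrystallineFramed (ρ.toLocal v))) →
      ¬ ParityClause F p ρ → ¬ BaseChangeType F p ρ → False

/-- Dropping both irreducibility clauses can only strengthen the crux (the informative converse fails on paper,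
see the docstring of `WithoutAnyIrreducibility`). [folklore] -/
theorem tensorSquareVoid_of_withoutAnyIrreducibility (h : WithoutAnyIrreducibility) : TensorSquareVoid :=
  fun F _ _ _ hF p _ ρ _ hunr hHT hG hE hB => h F hF p ρ hunr hHT ⟨hG.1, hG.2.1, hG.2.2.1⟩ hE hB

/-- Variant WITHOUT the negated parity clause: the conclusion reverts to "parallel".  VERDICT: conjecturally TRUE
(Calegari–Mazur) and provable off the dihedral locus by the same `ψ = ⊗-Ind ρ` (regular iff the gaps differ,
`tensorWeights_nodup_iff`; parity never enters); it is `TwistedInductionParallel ∧ TensorSquareParallel` restricted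
to `¬ BaseChangeType`.  Not load-bearing for truth; it only makes the conclusion void. [folklore] -/
def WithoutParityClause : Prop :=
  ∀ (F : Type) [Field F] [NumberField F] [Algebra.IsQuadraticExtension ℚ F], NumberField.IsTotallyComplex F →
    ∀ (p : ℕ) [Fact p.Prime] (ρ : FramedGaloisRep F (PadicAlgCl p) 2), ρ.toGaloisRep.IsIrreducible →
      (∀ᶠ v : HeightOneSpectrum (𝓞 F) in Filter.cofinite, ρ.IsUnramifiedAt v) →
      RegularShape F p ρ → GoodRegime F p ρ → ¬ BaseChangeType F p ρ → ParallelConclusion F p ρ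

/-- The parity-free variant implies the crux. [folklore] -/
theorem tensorSquareParallel_of_withoutParityClause (h : WithoutParityClause) : TensorSquareParallel :=
  tensorSquareParallel_iff_named.2 fun F _ _ _ hF p _ ρ hirr hunr hHT hG _ hB => h F hF p ρ hirr hunr hHT hG hB

/-! ## §3 Junk-loophole audit: abstract characters in the trace identities are forced to be trivial on `ker ρ̄` -/

section AbstractCharacters

variable {G k : Type*} [Group G] [Field k]

/-- Core computation: if `tr B = c · tr A` with `A = B = 1` in `GL₂(k)` and `2 ≠ 0` in `k`, then `c = 1`. [folklore] -/
theorem twistUnit_eq_one_of_trace (h2 : (2 : k) ≠ 0) {A B : GL (Fin 2) k} (hA : A = 1) (hB : B = 1) {c : kˣ}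
    (h : (B : Matrix (Fin 2) (Fin 2) k).trace = (c : k) * (A : Matrix (Fin 2) (Fin 2) k).trace) : c = 1 := by
  subst hA; subst hB
  have htr : ((1 : GL (Fin 2) k) : Matrix (Fin 2) (Fin 2) k).trace = 2 := by
    rw [Units.val_one, Matrix.trace_one, Fintype.card_fin]; norm_num
  rw [htr] at h
  have hc : (c : k) = 1 := by
    have : (2 : k) * ((c : k) - 1) = 0 := by linear_combination -h
    rcases mul_eq_zero.1 this with h0 | h0
    · exact absurd h0 h2
    · linear_combination h0
  exact Units.val_eq_one.1 hc

/-- **Dihedral predicate (lines `birth`/`merged`, hypothesis of `stub_dihedralType_of_trace`, negated hypothesis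
of `stub_residualIrreducibility`)**: an ABSTRACT `η : G →* kˣ` with `tr r(σ) = η(σ) tr r(σ)` for all `σ` is
trivial on `ker r` (`char k ≠ 2`), hence factors through the finite image of `r` — the missing continuity is
automatic. [folklore] -/
theorem dihedralChar_ker_le (h2 : (2 : k) ≠ 0) (r : G →* GL (Fin 2) k) (η : G →* kˣ)
    (hη : ∀ σ, ((r σ : GL (Fin 2) k) : Matrix (Fin 2) (Fin 2) k).trace =
      (η σ : k) * ((r σ : GL (Fin 2) k) : Matrix (Fin 2) (Fin 2) k).trace) :
    r.ker ≤ η.ker := by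
  intro σ hσ
  rw [MonoidHom.mem_ker] at hσ ⊢
  exact twistUnit_eq_one_of_trace h2 hσ hσ (hη σ)

/-- **Base-change clause of the crux**: an ABSTRACT `χ` with `tr r(σ') = χ(σ) tr r(σ)` whenever `σ'` is the
`θ`-image of `σ` is trivial at every `σ` with `r σ = 1` and `r σ' = 1`; for `r = ρ̄` these `σ` form the open
subgroup `ker ρ̄ ∩ θ⁻¹(ker ρ̄)`, so `χ` is continuous and `¬ BaseChangeType` as typed coincides with its intended
continuous reading. [folklore] -/
theorem baseChangeChar_eq_one_of_mem_ker (h2 : (2 : k) ≠ 0) (r : G →* GL (Fin 2) k) (χ : G →* kˣ)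
    {σ σ' : G} (hσ : r σ = 1) (hσ' : r σ' = 1)
    (h : ((r σ' : GL (Fin 2) k) : Matrix (Fin 2) (Fin 2) k).trace =
      (χ σ : k) * ((r σ : GL (Fin 2) k) : Matrix (Fin 2) (Fin 2) k).trace) : χ σ = 1 :=
  twistUnit_eq_one_of_trace h2 hσ hσ' h

/-- In the crux `k = ℤ̄_p/𝔪` with `11 ≤ p`, so `2 ≠ 0` there (tree: `charP_padicAlgClResidueField`). [folklore] -/
theorem two_ne_zero_padicAlgClResidueField (p : ℕ) [Fact p.Prime] (hp : p ≠ 2) :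
    (2 : padicAlgClResidueField p) ≠ 0 := by
  haveI := charP_padicAlgClResidueField p
  intro h
  have h' : ((2 : ℕ) : padicAlgClResidueField p) = 0 := by exact_mod_cast h
  rw [CharP.cast_eq_zero_iff (padicAlgClResidueField p) p] at h'
  have hp2 : p ≤ 2 := Nat.le_of_dvd (by norm_num) h'
  have := (Fact.out : p.Prime).two_le
  omega

end AbstractCharacters

/-! ## §4 Line `merged` — certified small-model facts for stubs 1 and 3, and the audit record -/

/-- **Regularity of the tensor induction is exactly "gaps differ"** (stub 1, clause (T3)): for `a < b`,
`a' < b'` the four weights `a+a', a+b', b+a', b+b'` are pairwise distinct iff `b - a ≠ b' - a'`.  In particular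
the mechanism is parity-blind (cf. `WithoutParityClause`). [folklore] -/
theorem tensorWeights_nodup_iff {a b a' b' : ℤ} (hab : a < b) (hab' : a' < b') :
    ({a + a', a + b', b + a', b + b'} : Multiset ℤ).Nodup ↔ b - a ≠ b' - a' := by
  simp only [Multiset.insert_eq_cons, Multiset.nodup_cons, Multiset.mem_cons, Multiset.mem_singleton,
    Multiset.nodup_singleton, and_true, not_or]
  omega

/-- The Gram matrix `J = alt ⊗ alt` on `V ⊗ V` (`V = k²` with `alt = [[0,1],[-1,0]]`), basis
`e₁⊗e₁, e₁⊗e₂, e₂⊗e₁, e₂⊗e₂`. [folklore] -/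
def J : Matrix (Fin 4) (Fin 4) ℤ := !![0, 0, 0, 1; 0, 0, -1, 0; 0, -1, 0, 0; 1, 0, 0, 0]

/-- The swap `v ⊗ w ↦ w ⊗ v` in the same basis (the image of complex conjugation under `⊗-Ind` when `c² = 1`). [folklore] -/
def swap : Matrix (Fin 4) (Fin 4) ℤ := !![1, 0, 0, 0; 0, 0, 1, 0; 0, 1, 0, 0; 0, 0, 0, 1]

/-- `J` is symmetric (stub 1 (T2): the pairing on `⊗-Ind ρ` is ORTHOGONAL). [folklore] -/
theorem J_isSymm : J.IsSymm := by decide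

/-- `det J = 1`, so `J` is a perfect pairing. [folklore] -/
theorem det_J : J.det = 1 := by decide

/-- The swap preserves `J` exactly: multiplier `μ(c) = 1` (stub 1 (T2): totally EVEN multiplier). [folklore] -/
theorem swap_transpose_mul_J_mul_swap : swap.transpose * J * swap = J := by decide

/-- The swap is an involution. [folklore] -/
theorem swap_mul_swap : swap * swap = 1 := by decide

/-- `tr(swap) = 2 = dim V` (stub 1 (T5): `tr ψ(c) = 2 ≠ 0`; this is what `stub_traceComplexConjugation`'s
conclusion `tr ψ(c) = 0` excludes — the Caraiani–Le Hung sign obstruction in its smallest model). [folklore] -/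
theorem trace_swap : swap.trace = 2 := by decide

/-- **Audit record of line `merged` (cycle 1; no stub refuted).**  The statement proved is a triviality; the
content is this docstring, kept next to the certified facts it cites.

* stub 1 `stub_tensorInductionPD` — TRUE on paper except its PD clause, which is OPEN in print for supersingular
  `ρ|Γ_{F_v}` of gap `≥ p - 1` (route-review §C; BLGGT Lemma 1.4.3 covers ordinary / Fontaine–Laffaille; item
  PD2Unram stmt-Langlands-14643); NOT refutable (PD is expected).  (T0)/(T2)/(T5) consistent: `J_isSymm`, `det_J`,
  `swap_transpose_mul_J_mul_swap`, `trace_swap`; (T3) regularity ⇔ gaps differ: `tensorWeights_nodup_iff`.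
  Caveat for the prover: (T3) asserts pinned CRYSTALLINITY of `ψ.toLocal v`, certifiable only through a
  `⊗`-closure property of THE datum's `IsWeilDeligneOf` that no clause (F1)–(F12) provides — expect to need
  `FontaineDatumExists` plus a NEW clause (tensor functoriality of `WD ∘ D_pst`), i.e. a literature-seat request,
  not a proof obligation you can meet today.
* stub 2 `stub_residualIrreducibility` — TRUE on paper (Clifford): with `r̄ = ρ̄|Γ_{F(ζ_p)}` abs. irreducible and
  not self-twisted (¬ dihedral, `η` may be taken on the finite image by `dihedralChar_ker_le`), a character inside
  `r̄ ⊗ r̄^c` gives `r̄^c ≃ r̄ ⊗ χ'` on `Γ_{F(ζ_p)}`; `Γ_F`-invariance of `χ'` follows from ¬ dihedral, `χ'` extends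
  through the CYCLIC quotient `Gal(F(ζ_p)/F)`, and then `ρ̄^c ≃ ρ̄ ⊗ χ̄δ` is base-change type — excluded; a `2 + 2`
  splitting of `r̄ ⊗ r̄^c` with both factors primitive forces projective equivalence, same conclusion.  (T0) pins
  `ψ|Γ_F` only up to semisimplification and `ψ` up to `⊗ η_{F/ℚ}` — harmless for residual irreducibility.
* stub 3 `stub_traceComplexConjugation` — faithful to BLGGT Thm C (`l ≥ 2(n+1) = 10`, a.e. unramified, PD +
  regular, `r̄|ℚ(ζ_l)` irreducible, polarized = symplectic-with-odd OR orthogonal-with-EVEN multiplier; sanity: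
  modular forms are `GSp₂` with `μ(c) = det ρ_f(c) = -1`, `ρ_f ⊗ ρ_g` is `GO₄` with `μ(c) = +1` and trace `0`) +
  Caraiani–Le Hung Thm 1.1 (`n` even ⇒ `tr r(c) = 0`).  No GO₄-even geometric `ψ` with `tr ψ(c) ≠ 0` is known
  (automorphic ones are excluded by CLH; `Ind_{K real quadratic}` of Hilbert forms are symplectic-odd with trace
  `0`); not refutable.  Pinned-crystallinity of `ψ` sits in HYPOTHESIS position here (safe).
* stub 4 `stub_dihedralType_of_trace` — TRUE against the tree's `IsDihedralType := ∃ m ≥ 2, PIm ≃* DihedralGroup m`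
  (the Klein-four case `m = 2`, three self-twists, IS included — checked, this was the candidate kill): `η` factors
  through `H̄ = im r̄` (`dihedralChar_ker_le`, `two_ne_zero_padicAlgClResidueField`), `tr = η̄ · tr` on `H̄` gives
  `r̄ ≃ r̄ ⊗ η̄` (linear independence of characters of abs. irreducible modules, any characteristic), `η̄² = 1`,
  `r̄ = Ind_C θ`, `PIm = C/ker(θ/θˢ) ⋊ ⟨w̄⟩ ≅ D_m`, `m = ord(θ/θˢ) ≥ 2`, `w̄² = 1` since `w² = ab·1`; `|im r̄| = 2·|im(θ,θˢ)|`
  is prime to `p` (odd).  Finite image: reductions have open kernel (tree).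
* stub 5 `stub_enormousResidualPackage` — TRUE on paper against `Subgroup.IsEnormous` (ACC+ 6.2.28 verbatim): (1)
  `|H̄|` prime to `p`; (2a) Schur; (2b) `|H̄| ∈ kˣ`; (3) `ad⁰ = ε ⊕ Ind(θ/θˢ)`: Cartan element with `θ ≠ θˢ` for
  `ε`, a reflection `(0 a; b 0)` (char. poly `X² - ab`, separable, fixed vector `E₁₂ + (b/a)E₂₁`) for `Ind`; in
  the Klein-four case `ad⁰ = ε₁ ⊕ ε₂ ⊕ ε₃` and non-central elements of `ker εᵢ` are regular semisimple.  Decomposed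
  generic: for prime-to-`p` image every non-scalar element is regular semisimple, `Γ_{F(ζ_p)}` is not the union of
  the two proper subgroups `S ∩ Γ₁`, `θ_c⁻¹(S) ∩ Γ₁` (`S` = scalar locus), Chebotarev — but NOTE the tree's proved
  CN 6.2.2 (`isDecomposedGeneric_of_isAbsolutelyIrreducible_restrictField_cyclotomic`) is typed for `ZMod p`
  coefficients only; the stub needs it for `padicAlgClResidueField p`.  Scalar element outside `Γ_{F(ζ_p)}`:
  `D_m^{ab} ∈ {C₂, C₂²}` has no cyclic quotient of order `p - 1 ≥ 10`.
* stub 6 `stub_ordinaryDihedralVoid` — does NOT assume `11 ≤ p`, `p` split or `p` odd; still not refutable (no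
  non-parallel nearly-ordinary `ρ` is known for any `p`; inert `p`: two labels at one place, purity still bites),
  but the prover should compare with the EXACT hypotheses of the vendored `Qian2022.potentialAutomorphy_ordinary`
  (`ℓ` vs `F`, `F₀`-split conditions) before relying on it at `p = 2, 3` or `p` ramified.
* stub 7 `stub_supersingularDihedral` — the open remainder; same status as the crux (§5).
* Joint sufficiency: `Merged.TensorSquareParallel_of` is kernel-checked (PICKED.md); no smuggled gap. [folklore] -/
theorem lineMergedAudit : True := trivial

end Summit.Langlands.Langlands.Cruxes.TensorSquareParallel.Disproof

end
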